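import Summits.HubbardSuperconductivity.HubbardSuperconductivity.Theorems.AnisotropyChordTransferFibre3FinXDCheck

/-!
# Route `AnisotropyChord` / H0 rotor rung: FIN per-`L` row-D (KT-2a″) SUB-CELL facts, `L = 9` (102–107)

Row-D facts `xdCellAny0 9 (49/50) la lb aD = true` on quarter sub-cells of the combined cells whose side condition needs `aD ≈ .04` (mechhunt STATUS p3 g7 REPORT 3).
Prover seat `hubbard-h0-rotor-p3` g7; helper for piece A = stmt-HubbardSuperconductivity-23918 of rung 19089 (`--supports`, helper class).
WHAT THIS IS NOT: nothing here proves superconductivity in the Hubbard model (rotor TARGET as worded stays FALSE, g15 verdict); kernel facts /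
assembly for ONE conditional reduction at one `L`.  No sorry.
-/

set_option linter.dupNamespace false
set_option autoImplicit false

namespace Summit.HubbardSuperconductivity.HubbardSuperconductivity.Theorems.AnisotropyChord.Transfer.Fibre3

namespace FinXD

/-- row-D sub-cell `[20189981871301633, 20314611389025717]` of `L = 9`. [folklore] -/
theorem xd9s_136_2 : xdCellAny0 9 (49/50 : ℚ) 20189981871301633 20314611389025717 (1/25 : ℚ) = true := by decide +kernel

/-- row-D sub-cell `[20314611389025717, 20439240906749801]` of `L = 9`. [folklore] -/
theorem xd9s_136_3 : xdCellAny0 9 (49/50 : ℚ) 20314611389025717 20439240906749801 (1/25 : ℚ) = true := by decide +kernel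

/-- row-D sub-cell `[20439240906749801, 20566986162416987]` of `L = 9`. [folklore] -/
theorem xd9s_137_0 : xdCellAny0 9 (49/50 : ℚ) 20439240906749801 20566986162416987 (1/25 : ℚ) = true := by decide +kernel

/-- row-D sub-cell `[20566986162416987, 20694731418084173]` of `L = 9`. [folklore] -/
theorem xd9s_137_1 : xdCellAny0 9 (49/50 : ℚ) 20566986162416987 20694731418084173 (1/25 : ℚ) = true := by decide +kernel

/-- row-D sub-cell `[20694731418084173, 20822476673751359]` of `L = 9`. [folklore] -/
theorem xd9s_137_2 : xdCellAny0 9 (49/50 : ℚ) 20694731418084173 20822476673751359 (1/25 : ℚ) = true := by decide +kernel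

/-- row-D sub-cell `[20822476673751359, 20950221929418545]` of `L = 9`. [folklore] -/
theorem xd9s_137_3 : xdCellAny0 9 (49/50 : ℚ) 20822476673751359 20950221929418545 (1/25 : ℚ) = true := by decide +kernel

end FinXD

end Summit.HubbardSuperconductivity.HubbardSuperconductivity.Theorems.AnisotropyChord.Transfer.Fibre3
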